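import Summits.BirchSwinnertonDyer.BirchSwinnertonDyer.Theorems.ThetaPartnerAtTwoSignedKatoUpToAtTwoOffTwoRoad
import HarnessLib

/-!
# Route `ThetaPartnerAtTwo` (TP2), crux K3 `SignedKatoDivisibilityUpToAtTwo` (item stmt-BirchSwinnertonDyer-20308),
# line `colemanrat` v3: what a `2`-adic `+`/♭ COLEMAN–POITOU–TATE PACKAGE must deliver — stub (C2)
# `stub_colemanLengthTwo` from a Kobayashi (7.21) + Thm. 6.3 ∕ Sprung 2012 (3) + Def. 6.1 -SHAPED package AT `p = 2`
# in its weakest, `2`-robust form (lead `bsd-wall-tp2-p2x`; route-independent — no `Theses` import)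

HONEST FRAMING (cell `bsd-wall`): THEOREMS ONLY — no definition, no named fact, no instance, no `sorry`; the
displayed hypothesis IS research at `p = 2` (Sprung 2012 §7, p. 1499: «From now on, assume p is odd»; tree barrier
`SignedIwasawaTheoryAtTwoBarrier` (B3)); nothing about any Selmer group is asserted; closes no item; BSD is NOT
proved by any of this.

## What is proved

`colemanLengthTwo_of_colemanPackageTwo`: the registered stub (C2) `stub_colemanLengthTwo` of the skeleton
`Cruxes/SignedKatoDivisibilityUpToAtTwo/Lines/colemanrat.lean` v3 — for every habitat datum, dual datum `D` of
`Sel⁺(E/ℚ_∞)` and height-one `𝔭 ∌ 2`, a non-zero GENUINE `2`-adic Euler-system class `s` with `ℓ_𝔭(𝐇¹/Λs) < ⊤`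
and the four-term inequality `ℓ_𝔭(X⁺) + ℓ_𝔭(𝐇¹/Λs) ≤ ℓ_𝔭(X₀) + ℓ_𝔭(Λ/(L♭))` — FOLLOWS from the existence, for
the same data, of a **`2`-adic Coleman–Poitou–Tate package**:
* a submodule `P ≤ Λ` (the image of `Col⁺ = Col♭`; NO surjectivity asked — Kobayashi Thm. 6.2 / Sprung Prop. 7.3
  are printed for `p` odd) and an INJECTIVE `Λ`-linear `col : 𝐇¹_Γ(T₂E) → P` (`Col⁺ ∘ loc₂`; injective =
  Kobayashi Thm. 7.3 i), from `𝐇¹` torsion free of rank one + `Col⁺(z) ≠ 0` + Rohrlich),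
* `Λ`-linear `j : P → X⁺(E/ℚ_∞)`, `k : X⁺ → X₀(E/ℚ_∞)` with `𝐇¹ →ᶜᵒˡ P →ʲ X⁺ →ᵏ X₀` exact at `P` and at `X⁺`
  (Kobayashi (7.17)–(7.21) ∕ Sprung's sequence (3) in the proof of Thm. 7.14: Cassels–Poitou–Tate along
  `ℚ(μ_{2^∞})` with the `♭` local condition `E⁺ ⊗ ℚ₂/ℤ₂ = (Ker Col⁺)^⊥`, then the `Δ = {±1}` descent to `ℚ_∞`
  — exactness AS MAPS may be relaxed to "up to modules killed by a power of `2`" by whoever proves it: only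
  lengths at `𝔭 ∌ 2` are consumed),
* a non-zero genuine `2`-adic Euler-system class `s` (Kato's `(c,d,a(A))`-zeta lift at `2`:
  `Kato2004.IwasawaH1Data.existsUnique_lift_of_zetaBody_two`) with `ℓ_𝔭(𝐇¹/Λs) < ⊤` and
  **`ℓ_𝔭(Λ/(col s)) ≤ ℓ_𝔭(Λ/(L♭))`**, i.e. `v_𝔭(Col⁺(s)) ≤ v_𝔭(L♭)` — Kobayashi Thm. 6.3 ∕ Sprung Def. 6.1 +
  Remark 6.16 at `2` («`Col⁺(z_Kato) = L⁺`» up to the `(c,d)`-Euler factor `μ_{c,d}`, a `2`-adic unit of the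
  period and a power of `2`; choose `(c,d)` with `μ_{c,d} ∉ 𝔭`, Kato Prop. 13.7-type),
by the landed four-term inequality `SignedKatoOffTwo.fourTerm_lengthAt_le` (§1 of `…OffTwoRoad`). This is the
`p = 2`-robust replacement of `Kobayashi2003.SignedColemanKatoData` (whose `zeta_le_span` runs over the odd-`p`
class predicate `Kato2004.IsEulerSystemClass`, EMPTY of Kato's classes at `2`, and whose image clause is stated at
every height-one prime, `(2)` included).

References: [Kobayashi2003] Thm. 6.2–6.3 (p. 11), Prop. 7.1, (7.17)–(7.21), Thm. 7.3 (pp. 12–13); [Sprung2012]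
Def. 6.1 (p. 1495), Remark 6.16, §7 (p. 1499), Prop. 7.3 (p. 1500), proof of Thm. 7.14 sequence (3), Prop. 7.17
(Kurihara), Thm. 7.18 (= Kato 12.5) (p. 1504); [Kato2004Asterisque] Thm. 12.5 (p. 222), Prop. 13.7 (p. 227).
-/

set_option autoImplicit false
-- the Theorems namespace of this sub repeats the summit name by design (D-0017 nested layout)
set_option linter.dupNamespace false

noncomputable section

open scoped Classical MatrixGroups ModularForm NumberField

open CongruenceSubgroup WeierstrassCurve Field IsDedekindDomain
  Literature.NumberTheory.GaloisRepresentations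
  Literature.NumberTheory.EllipticCurves Literature.NumberTheory.EllipticCurves.ModularForms
  Literature.NumberTheory.EllipticCurves.Module Literature.NumberTheory.EllipticCurves.Rank1Residual
  Literature.NumberTheory.EllipticCurves.Kobayashi2003 Literature.NumberTheory.EllipticCurves.Kato2004
  Literature.NumberTheory.EllipticCurves.Kato2004.EulerSystemValues ZpExtension
  Summit.BirchSwinnertonDyer.Rank1Residual.Supersingular

namespace Summit.BirchSwinnertonDyer.BirchSwinnertonDyer.Theorems

namespace SignedKatoOffTwo

/-- **Stub (C2) from a `2`-adic Coleman–Poitou–Tate package.** If for every habitat datum, dual datum `D` of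
`Sel⁺(E/ℚ_∞)` (torsion) and height-one `𝔭 ∌ 2` there are pinned `I`, `Y`, a submodule `P ≤ Λ`, an injective
`col : 𝐇¹_Γ(T₂E) → P`, maps `j : P → X⁺`, `k : X⁺ → X₀` exact at `P` and at `X⁺`, and a non-zero genuine `2`-adic
Euler-system class `s` with `ℓ_𝔭(𝐇¹/Λs) < ⊤` and `ℓ_𝔭(Λ/(col s)) ≤ ℓ_𝔭(Λ/(L♭))`, then (C2) holds: the four-term
inequality is `fourTerm_lengthAt_le` followed by that last comparison. [cite: Kobayashi2003, Thm. 7.3 (7.21) and proof of Thm. 7.4 (p. 13), Thm. 6.3 (p. 11)]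
[cite: Sprung2012, Def. 6.1 (p. 1495) and proof of Thm. 7.14, sequence (3) (p. 1504)] [cite: Kato2004Asterisque, Prop. 13.7 (p. 227)] -/
theorem colemanLengthTwo_of_colemanPackageTwo
    (hPkg : ∀ (W : WeierstrassCurve ℚ) [W.IsElliptic] [W.IsGloballyMinimal],
      ¬ W.HasCM → W.analyticRank = 0 → GoodSS W 2 → W.frobeniusTrace 2 = 0 →
      ∀ (κ : ZpExtension ℚ 2) (γ : Field.absoluteGaloisGroup ℚ) (hκ : κ.IsCyclotomic),
        κ.IsTopGenerator γ → IsCyclotomicVariable 2 γ →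
        ∀ [NeZero (W.conductorNorm ℤ)] (f : CuspForm (Gamma0 (W.conductorNorm ℤ)) 2),
          IsNewformOf W f → ∀ (ϖ : ℚ), (ϖ : ℝ) * W.realPeriodRat = plusPeriod f →
        ∀ (Lplus Lminus : IwasawaAlgebra 2), IsPollackPair f 2 Lplus Lminus →
        ∀ (D : SignedSelmerDualData W κ γ 1) [ContinuousSMul ℤ_[2] (W.tateModule 2)]
          [Module.Free ℤ_[2] (W.tateModule 2)] [Module.Finite ℤ_[2] (W.tateModule 2)],
          Module.IsTorsion (IwasawaAlgebra 2) D.X →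
          ∀ 𝔭 : PrimeSpectrum (IwasawaAlgebra 2), 𝔭.asIdeal.height = 1 →
            PowerSeries.C (2 : ℤ_[2]) ∉ 𝔭.asIdeal →
          ∃ (I : Kato2004.IwasawaH1Data W 2 κ γ) (Y : W.FineSelmerDualData κ γ)
            (P : Submodule (IwasawaAlgebra 2) (IwasawaAlgebra 2))
            (col : I.H →ₗ[IwasawaAlgebra 2] P) (j : P →ₗ[IwasawaAlgebra 2] D.X)
            (k : D.X →ₗ[IwasawaAlgebra 2] Y.X) (s : I.H),
            Function.Injective col ∧ Function.Exact col j ∧ Function.Exact j k ∧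
            (∃ (S : Set (HeightOneSpectrum (𝓞 ℚ))) (_ : S.Finite)
                (z : ∀ (k : ℕ) (r : (cyclotomicLevelsRat 2 S).Ideals),
                  H1 (tateRep W 2) ((cyclotomicLevelsRat 2 S).level k r.1)),
                IsEulerSystem (cyclotomicLevelsRat 2 S) (tateRep W 2) 2 z ∧
                (∀ (k : ℕ) (r : (cyclotomicLevelsRat 2 S).Ideals),
                  z k r ∈ integralH1 (tateRep W 2) 2 ((cyclotomicLevelsRat 2 S).level k r.1)) ∧
                ∀ n : ℕ, I.proj n s =
                  Kato2004.levelToLayerTwo W hκ S n (z (n + 2) (cyclotomicLevelsRat 2 S).idealOne)) ∧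
            s ≠ 0 ∧
            lengthAt (IwasawaAlgebra 2) (I.H ⧸ Submodule.span (IwasawaAlgebra 2) {s}) 𝔭 ≠ ⊤ ∧
            lengthAt (IwasawaAlgebra 2) (IwasawaAlgebra 2 ⧸ Ideal.span {(P.subtype (col s))}) 𝔭 ≤
              lengthAt (IwasawaAlgebra 2) (IwasawaAlgebra 2 ⧸ Ideal.span {kobayashiL 1 Lplus Lminus}) 𝔭) :
    ∀ (W : WeierstrassCurve ℚ) [W.IsElliptic] [W.IsGloballyMinimal],
      ¬ W.HasCM → W.analyticRank = 0 → GoodSS W 2 → W.frobeniusTrace 2 = 0 →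
      ∀ (κ : ZpExtension ℚ 2) (γ : Field.absoluteGaloisGroup ℚ) (hκ : κ.IsCyclotomic),
        κ.IsTopGenerator γ → IsCyclotomicVariable 2 γ →
        ∀ [NeZero (W.conductorNorm ℤ)] (f : CuspForm (Gamma0 (W.conductorNorm ℤ)) 2),
          IsNewformOf W f → ∀ (ϖ : ℚ), (ϖ : ℝ) * W.realPeriodRat = plusPeriod f →
        ∀ (Lplus Lminus : IwasawaAlgebra 2), IsPollackPair f 2 Lplus Lminus →
        ∀ (D : SignedSelmerDualData W κ γ 1) [ContinuousSMul ℤ_[2] (W.tateModule 2)]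
          [Module.Free ℤ_[2] (W.tateModule 2)] [Module.Finite ℤ_[2] (W.tateModule 2)],
          Module.IsTorsion (IwasawaAlgebra 2) D.X →
          ∀ 𝔭 : PrimeSpectrum (IwasawaAlgebra 2), 𝔭.asIdeal.height = 1 →
            PowerSeries.C (2 : ℤ_[2]) ∉ 𝔭.asIdeal →
          ∃ (I : Kato2004.IwasawaH1Data W 2 κ γ) (Y : W.FineSelmerDualData κ γ) (s : I.H),
            (∃ (S : Set (HeightOneSpectrum (𝓞 ℚ))) (_ : S.Finite)
                (z : ∀ (k : ℕ) (r : (cyclotomicLevelsRat 2 S).Ideals),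
                  H1 (tateRep W 2) ((cyclotomicLevelsRat 2 S).level k r.1)),
                IsEulerSystem (cyclotomicLevelsRat 2 S) (tateRep W 2) 2 z ∧
                (∀ (k : ℕ) (r : (cyclotomicLevelsRat 2 S).Ideals),
                  z k r ∈ integralH1 (tateRep W 2) 2 ((cyclotomicLevelsRat 2 S).level k r.1)) ∧
                ∀ n : ℕ, I.proj n s =
                  Kato2004.levelToLayerTwo W hκ S n (z (n + 2) (cyclotomicLevelsRat 2 S).idealOne)) ∧
            s ≠ 0 ∧
            lengthAt (IwasawaAlgebra 2) (I.H ⧸ Submodule.span (IwasawaAlgebra 2) {s}) 𝔭 ≠ ⊤ ∧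
            lengthAt (IwasawaAlgebra 2) D.X 𝔭 +
                lengthAt (IwasawaAlgebra 2) (I.H ⧸ Submodule.span (IwasawaAlgebra 2) {s}) 𝔭 ≤
              lengthAt (IwasawaAlgebra 2) Y.X 𝔭 +
                lengthAt (IwasawaAlgebra 2) (IwasawaAlgebra 2 ⧸ Ideal.span {kobayashiL 1 Lplus Lminus}) 𝔭 := by
  intro W _ _ hcm hr hss ha κ γ hκ hγ hcv _ f hf ϖ hϖ Lplus Lminus hPP D _ _ _ hX 𝔭 h𝔭 hp𝔭
  obtain ⟨I, Y, P, col, j, k, s, hcol, hcj, hjk, hES, hs0, hfin, hdiv⟩ :=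
    hPkg W hcm hr hss ha κ γ hκ hγ hcv f hf ϖ hϖ Lplus Lminus hPP D hX 𝔭 h𝔭 hp𝔭
  refine ⟨I, Y, s, hES, hs0, hfin, ?_⟩
  exact (fourTerm_lengthAt_le P.subtype P.injective_subtype col hcol j k hcj hjk s 𝔭).trans
    (add_le_add le_rfl hdiv)

end SignedKatoOffTwo

end Summit.BirchSwinnertonDyer.BirchSwinnertonDyer.Theorems

end
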